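import Literature.AnabelianGeometry.SemiGraphs.PSCFundamentalGroup
import HarnessLib

/-!
# [NodNon] Lemma 1.9 (ii): graph-theoretic geometry via verticial subgroups (coset coordinates)

Hoshi–Mochizuki, *On the combinatorial anabelian geometry of nodally nondegenerate outer
representations*, Hiroshima Math. J. **41** (2011) 275–342 [cite: HoshiMochizukiNodNon2011, Lem 1.9 (ii) p.291]
("[NodNon]" in the IUT corpus; cited by [IUTchI] Prop. 2.1, Cor. 2.3, Prop. 2.4 as "[AbsTopII],
Proposition 1.3, (iv), or [NodNon], Proposition 3.9, (i)").  Setting of §1 (p. 284): `Σ` a nonempty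
set of primes, `G` a semi-graph of anabelioids of pro-`Σ` PSC-type with (finite) underlying semi-graph
`𝔾`, `Π_G` its pro-`Σ` fundamental group, `G̃ → G` a fixed universal covering,
`Vert(G̃) := lim Vert(𝔾′)` over the connected finite étale subcoverings (Def. 1.1 (ii)), `Π_ṽ ⊆ Π_G`
the verticial subgroup of `ṽ ∈ Vert(G̃)` (Def. 1.1 (vi)), `d(ṽ, w̃)` the distance (Def. 1.1
(vii)–(viii): the sup of the distances of the images in the finite subcoverings; `d = 1` means
"joined by a node").

> **Lemma 1.9 (Graph-theoretic geometry via verticial subgroups).** For `i = 1, 2`, let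
> `ṽᵢ ∈ Vert(G̃)`. Then the following hold: (i) If `Π_{ṽ₁} ∩ Π_{ṽ₂} ≠ {1}`, then either
> `Π_{ṽ₁} = Π_{ṽ₂}` or `Π_{ṽ₁} ∩ Π_{ṽ₂}` is a nodal subgroup of `Π_G`. (ii) Consider the following
> three (mutually exclusive) conditions: (1) `d(ṽ₁, ṽ₂) = 0`. (2) `d(ṽ₁, ṽ₂) = 1`. (3)
> `d(ṽ₁, ṽ₂) ≥ 2`. Then we have equivalences (1) ⇔ (1′); (2) ⇔ (2′) ⇔ (2″); (3) ⇔ (3′) with the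
> following four conditions: (1′) `Π_{ṽ₁} = Π_{ṽ₂}`. (2′) `Π_{ṽ₁} ≠ Π_{ṽ₂}`, `Π_{ṽ₁} ∩ Π_{ṽ₂} ≠ {1}`.
> (2″) `Π_{ṽ₁} ∩ Π_{ṽ₂}` is a nodal subgroup of `Π_G`. (3′) `Π_{ṽ₁} ∩ Π_{ṽ₂} = {1}`.  (p. 291)

> **Lemma 1.7.** Let `ṽ ∈ Vert(G̃)`, `ẽ ∈ Edge(G̃)`. Then the following are equivalent: (i)
> `ẽ ∈ ℰ(ṽ)`. (ii) `Π_ṽ ∩ Π_ẽ ≠ {1}`. In particular, if `Π_ṽ ∩ Π_ẽ ≠ {1}`, then `Π_ẽ ⊆ Π_ṽ`. (p. 290)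

**Typing (the tree's vocabulary).**  The tree records a semi-graph of anabelioids of pro-`Σ` PSC-type
through its fundamental group only: abc-iut-L3's `PSCDatum P` ([CombGC] Def. 1.1 (ii)) = the
semi-graph `𝔾` with ONE representative verticial subgroup `Π_v = G.vertGp v` per vertex and ONE
representative nodal subgroup `Π_e = G.nodeGp e` per node (incidences up to conjugation).  The
universal covering is not an object of the tree, so the lemma is stated in COSET COORDINATES, which
is how [IUTchI] §2 consumes it (`Literature.IUT.HodgeTheaters.TemperedGraphGroupData.prop21_of_cosetTree`):
choose reference pro-vertices `ṽ_v` over `v` with `Π_{ṽ_v} = Π_v` and reference pro-nodes `ẽ_e` with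
`Π_{ẽ_e} = Π_e` (Remark 1.1.1: "`z̃` completely determines the subgroup `Π_z̃`, `z` only determines
the `Π_G`-conjugacy class").  Since `Π_G` acts transitively on the pro-vertices over `v` with
stabiliser `Π_{ṽ_v}`, the pro-vertices over `v` are the `g·ṽ_v`, `g ∈ Π_G/Π_v`, with
`Π_{g·ṽ_v} = g Π_v g⁻¹`; likewise the pro-nodes over `e` are the `k·ẽ_e`, `k ∈ Π_G/Π_e`.  By Lemma
1.7 and Lemma 1.8 ("nonexistence of loops" in `G̃`) the two end-points of `ẽ_e` are
`c₁(e)·ṽ_{src e} ≠ c₂(e)·ṽ_{tgt e}` for elements `c₁(e), c₂(e) ∈ Π_G` characterised by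
`Π_e ⊆ cᵢ(e) Π_{vᵢ} cᵢ(e)⁻¹` (`{src e, tgt e}` = the vertices of `𝔾` to which `e` abuts) — such a
choice is an `EndpointData` below — and then the end-points of `k·ẽ_e` are `k cᵢ(e)·ṽ_{vᵢ}`.  In these
coordinates the implication of Lemma 1.9 (ii) used by [IUTchI] — `Π_{ṽ₁} ∩ Π_{ṽ₂} ≠ {1}` ⇒
`d(ṽ₁, ṽ₂) ≤ 1`, i.e. (1′)∨(2′) ⇒ (1)∨(2) — reads as the predicate `VerticialIntersectionNear`.
It is a PREDICATE on the datum (it holds for the `PSCDatum` of a semi-graph of anabelioids of pro-`Σ`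
PSC-type; the model-relative comparison is not asserted, as for the other [CombGC]/[AbsTopII]
predicates of the tree), never asserted.
-- TODO(general form): the full trichotomy of Lemma 1.9 (ii) with the distance function on
-- `Vert(G̃)`, and Lemma 1.9 (i) (the intersection is nodal), once the universal pro-covering is typed.
-/

namespace Literature.AnabelianGeometry.SemiGraphs

open scoped Pointwise

universe u

namespace PSCDatum

variable {P : Type u} [Group P] [TopologicalSpace P] (G : PSCDatum P)

/-- **End-point data** for the nodes of `𝔾` in coset coordinates ([NodNon] Def. 1.1 (ii), (iv), (vi),
pp. 284–285, with Lemma 1.7 p. 290 and Lemma 1.8 p. 290): for each node `e`, an orientation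
`{src e, tgt e} = 𝒱(e)` and elements `c₁(e), c₂(e) ∈ Π_G` such that the reference pro-node `ẽ_e`
(`Π_{ẽ_e} = Π_e`) has end-points `c₁(e)·ṽ_{src e}` and `c₂(e)·ṽ_{tgt e}` — by Lemma 1.7
("if `Π_ṽ ∩ Π_ẽ ≠ {1}`, then `ẽ ∈ ℰ(ṽ)`") exactly the inclusions `Π_e ⊆ cᵢ(e) Π_{vᵢ} cᵢ(e)⁻¹`, together
with, for a node both of whose branches abut to the same vertex, the distinctness of the two
end-points `c₁(e)·ṽ_v ≠ c₂(e)·ṽ_v` (Lemma 1.8: `G̃` has no loops), i.e. `c₁(e)⁻¹ c₂(e) ∉ Π_v`.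
[cite: HoshiMochizukiNodNon2011, Def 1.1 (vi) p.285] -/
structure EndpointData : Type u where
  /-- the vertex to which the first branch of the node `e` abuts -/
  src : G.graph.N → G.graph.V
  /-- the vertex to which the second branch of the node `e` abuts -/
  tgt : G.graph.N → G.graph.V
  /-- `c₁(e)`: the end-point of `ẽ_e` over `src e` is `c₁(e)·ṽ_{src e}` -/
  c₁ : G.graph.N → P
  /-- `c₂(e)`: the end-point of `ẽ_e` over `tgt e` is `c₂(e)·ṽ_{tgt e}` -/
  c₂ : G.graph.N → P
  /-- `{src e, tgt e}` are the vertices of `𝔾` to which `e` abuts -/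
  nodeEnds_eq : ∀ e, G.graph.nodeEnds e = s(src e, tgt e)
  /-- `Π_{ẽ_e} ⊆ Π_{c₁(e)·ṽ_{src e}} = c₁(e) Π_{src e} c₁(e)⁻¹` -/
  nodeGp_le_src : ∀ e, G.nodeGp e ≤ MulAut.conj (c₁ e) • G.vertGp (src e)
  /-- `Π_{ẽ_e} ⊆ Π_{c₂(e)·ṽ_{tgt e}} = c₂(e) Π_{tgt e} c₂(e)⁻¹` -/
  nodeGp_le_tgt : ∀ e, G.nodeGp e ≤ MulAut.conj (c₂ e) • G.vertGp (tgt e)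
  /-- the two end-points of `ẽ_e` are distinct pro-vertices (no loops in `G̃`) -/
  loop_ne : ∀ e, src e = tgt e → (c₁ e)⁻¹ * c₂ e ∉ G.vertGp (src e)

/-- **[NodNon] Lemma 1.9 (ii), the implication `Π_{ṽ₁} ∩ Π_{ṽ₂} ≠ {1} ⇒ d(ṽ₁, ṽ₂) ≤ 1`**
((1′)∨(2′) ⇒ (1)∨(2), p. 291), in coset coordinates (module docstring): for every end-point data and
all pro-vertices `g·ṽ_v`, `h·ṽ_w` — if `g Π_v g⁻¹ ∩ h Π_w h⁻¹ ≠ {1}` then EITHER `g·ṽ_v = h·ṽ_w`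
(`v = w` and `g⁻¹h ∈ Π_v`) OR the two pro-vertices are the end-points `k c₁(e)·ṽ_{src e}`,
`k c₂(e)·ṽ_{tgt e}` of a pro-node `k·ẽ_e`.  A predicate on the datum (true for the `PSCDatum` of a
semi-graph of anabelioids of pro-`Σ` PSC-type), not asserted.  This is the form consumed by [IUTchI]
Prop. 2.1 (`TemperedGraphGroupData.prop21_of_cosetTree`, hypothesis `hA3`).
[cite: HoshiMochizukiNodNon2011, Lem 1.9 (ii) p.291] -/
def VerticialIntersectionNear : Prop :=
  ∀ (ε : G.EndpointData) (v w : G.graph.V) (g h : P),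
    MulAut.conj g • G.vertGp v ⊓ MulAut.conj h • G.vertGp w ≠ ⊥ →
      (v = w ∧ g⁻¹ * h ∈ G.vertGp v) ∨
      ∃ (e : G.graph.N) (k : P), ∃ p ∈ G.vertGp (ε.src e), ∃ q ∈ G.vertGp (ε.tgt e),
        (ε.src e = v ∧ ε.tgt e = w ∧ g = k * ε.c₁ e * p ∧ h = k * ε.c₂ e * q) ∨
        (ε.src e = w ∧ ε.tgt e = v ∧ h = k * ε.c₁ e * p ∧ g = k * ε.c₂ e * q)

end PSCDatum

end Literature.AnabelianGeometry.SemiGraphs
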